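import Mathlib.LinearAlgebra.Dimension.Finrank
import Mathlib.LinearAlgebra.FiniteDimensional.Lemmas
import Mathlib.Algebra.BigOperators.Group.Finset.Basic
import HarnessLib

/-!
# The greedy pivot family of an ordered family of vectors is canonical and is a basis of its span
(w1-cx-2 gen 14; second kernel leg of the «×2 ∕ ×3 ACROSS KERNELS» results of the W1 census chapter)

Cell pub-hsemireg, W1 «objects beyond sheaves», model level.  Gauge B's strong deformation retract is
built by ONE greedy elimination in a fixed global order: running through the ordered basis
`e₁ < e₂ < …` of the cochain space, an element goes to the set `K` («non-cycles») exactly when its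
boundary `d eᵢ` is NOT a combination of the earlier boundaries `d eⱼ, j < i`; then `B = d(K)` and the
homotopy is `(d|_K)⁻¹` on `B`.  Three independent programs (codes B, C, D of the cell) produce the same
`K`, hence the same `h` (HOME/INBOX RESULT #9 of the w1-cx-2 lineage; companion leaf
`CanonicalReducedBasis.lean` for the chart bases).  The linear algebra underneath, PLAIN (no
definitions): for a family `v : ι → V` over a finite linear order (`v = d ∘ e` in the application) let
`P` be the set of GREEDY PIVOTS, `i ∈ P ↔ v i ∉ span {v j | j < i}` (hypothesis `hP`).  Then

* every `v i` lies in the span of the pivot vectors (`mem_span_pivot`), so the pivot vectors span the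
  same space as the whole family (`span_pivot_eq`);
* the pivot vectors are linearly independent (`linearIndependent_pivot`);
* hence their number is the dimension of the span (`card_pivot_eq_finrank`).

`P` is by definition a function of `(v, ≤)` alone — the «non-cycle set» of the greedy SDR cannot depend
on the program computing it —, and the three facts say it is the right set (a basis of the boundaries).
Elementary (pivot columns of Gaussian elimination); recorded because results of record rest on it.
Nothing here says HC, HC_CM or HC_AV is proved.
-/

namespace Summit.Ventures.HSemireg.GreedyPivotFamily

open BigOperators

variable {K : Type*} [Field K] {V : Type*} [AddCommGroup V] [Module K V]
variable {ι : Type*} [LinearOrder ι]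

/-- A pivot vector is non-zero (it is not even in the span of its predecessors). -/
theorem ne_zero_of_pivot (v : ι → V) {i : ι}
    (hi : v i ∉ Submodule.span K (v '' {j | j < i})) : v i ≠ 0 := by
  intro h
  exact hi (h ▸ Submodule.zero_mem _)

/-- The pivot vectors are linearly independent: in a vanishing combination, the LARGEST index with a
non-zero coefficient would be a pivot lying in the span of its predecessors. -/
theorem linearIndependent_pivot (v : ι → V) (P : Finset ι)
    (hP : ∀ i ∈ P, v i ∉ Submodule.span K (v '' {j | j < i})) :
    LinearIndependent K (fun i : P => v i) := by
  classical
  rw [Fintype.linearIndependent_iff]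
  intro g hg
  by_contra hcon
  push Not at hcon
  obtain ⟨i₀, hi₀⟩ := hcon
  have hS : (Finset.univ.filter fun i : P => g i ≠ 0).Nonempty := ⟨i₀, by simp [hi₀]⟩
  set i := (Finset.univ.filter fun i : P => g i ≠ 0).max' hS with hi
  have himem : g i ≠ 0 := by
    have := Finset.max'_mem _ hS; rw [Finset.mem_filter] at this; exact this.2
  -- isolate the i-th term
  have hsplit : g i • v i = -(∑ j ∈ Finset.univ.erase i, g j • v j) := by
    have := Finset.add_sum_erase Finset.univ (fun j : P => g j • v j) (Finset.mem_univ i)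
    rw [hg] at this
    exact eq_neg_of_add_eq_zero_left this
  -- every other term lies in the span of the predecessors of i
  have hmem : (∑ j ∈ Finset.univ.erase i, g j • v (j : ι)) ∈
      Submodule.span K (v '' {k | k < (i : ι)}) := by
    refine Submodule.sum_mem _ fun j hj => ?_
    by_cases hgj : g j = 0
    · rw [hgj, zero_smul]; exact Submodule.zero_mem _
    · have hji : j ≠ i := Finset.ne_of_mem_erase hj
      have hle : j ≤ i := Finset.le_max' _ j (by simp [hgj])
      have hlt : (j : ι) < (i : ι) :=
        lt_of_le_of_ne (Subtype.coe_le_coe.mpr hle) (fun h => hji (Subtype.ext h))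
      exact Submodule.smul_mem _ _ (Submodule.subset_span ⟨j, hlt, rfl⟩)
  have hvi : v (i : ι) ∈ Submodule.span K (v '' {k | k < (i : ι)}) := by
    have h2 : v (i : ι) = (g i)⁻¹ • (g i • v (i : ι)) := by
      rw [smul_smul, inv_mul_cancel₀ himem, one_smul]
    rw [h2, hsplit]
    exact Submodule.smul_mem _ _ (Submodule.neg_mem _ hmem)
  exact hP i i.2 hvi

variable [Fintype ι]

/-- Every vector of the family lies in the span of the pivot vectors (strong induction along the
order: a non-pivot lies in the span of its predecessors, which lie in the span of the pivots). -/
theorem mem_span_pivot (v : ι → V) (P : Finset ι)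
    (hP : ∀ i, i ∈ P ↔ v i ∉ Submodule.span K (v '' {j | j < i})) (i : ι) :
    v i ∈ Submodule.span K (v '' (P : Set ι)) := by
  induction i using WellFoundedLT.induction with
  | ind i ih =>
    by_cases hi : i ∈ P
    · exact Submodule.subset_span ⟨i, hi, rfl⟩
    · have hmem : v i ∈ Submodule.span K (v '' {j | j < i}) := by
        by_contra h; exact hi ((hP i).mpr h)
      refine (Submodule.span_le.mpr ?_) hmem
      rintro _ ⟨j, hj, rfl⟩
      exact ih j hj

/-- The pivot vectors span the same subspace as the whole family. -/
theorem span_pivot_eq (v : ι → V) (P : Finset ι)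
    (hP : ∀ i, i ∈ P ↔ v i ∉ Submodule.span K (v '' {j | j < i})) :
    Submodule.span K (v '' (P : Set ι)) = Submodule.span K (Set.range v) := by
  apply le_antisymm
  · exact Submodule.span_mono (Set.image_subset_range _ _)
  · refine Submodule.span_le.mpr ?_
    rintro _ ⟨i, rfl⟩
    exact mem_span_pivot v P hP i

/-- Hence the number of pivots is the dimension of the span of the family: the greedy «non-cycle
count» is a function of the family, not of the program. -/
theorem card_pivot_eq_finrank (v : ι → V) (P : Finset ι)
    (hP : ∀ i, i ∈ P ↔ v i ∉ Submodule.span K (v '' {j | j < i})) :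
    P.card = Module.finrank K (Submodule.span K (Set.range v)) := by
  classical
  have hli : LinearIndependent K (fun i : P => v i) :=
    linearIndependent_pivot v P (fun i hi => (hP i).mp hi)
  have h1 : Module.finrank K (Submodule.span K (Set.range fun i : P => v (i : ι))) =
      Fintype.card P := finrank_span_eq_card hli
  have hrange : Set.range (fun i : P => v (i : ι)) = v '' (P : Set ι) := by
    ext x; constructor
    · rintro ⟨⟨i, hi⟩, rfl⟩; exact ⟨i, hi, rfl⟩
    · rintro ⟨i, hi, rfl⟩; exact ⟨⟨i, hi⟩, rfl⟩
  rw [hrange, span_pivot_eq v P hP] at h1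
  rw [h1, Fintype.card_coe]

end Summit.Ventures.HSemireg.GreedyPivotFamily
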